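import Summits.BirchSwinnertonDyer.BirchSwinnertonDyer.Theorems.SchneiderFreeAdditiveX3PoitouTateMuMiddleExactReal
import Literature.NumberTheory.GaloisCohomology.PoitouTatePrimaryReduction
import Literature.NumberTheory.EllipticCurves.KummerSequenceConnecting
import Literature.AnabelianGeometry.AbsoluteAnabelian.GaloisCyclotomeTowerLevels
import HarnessLib

/-!
# Poitou–Tate toolkit (μₙ-case at EVERY level, 1/·): the level change `Hom(μ_a, μ_a) → Hom(μ_N, μ_N)`
# for `a ∣ N` and the cup product of a Kummer class with the class of a NON-surjective character

Cell `bsd-schneider-ideate`, seat `bsd-schneider-door-c6` (prover, generation 7).  PARTITION: board row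
B6 ∩ X3 ∩ sst-twist, `r = 1` — CONTROL corner (crux `AnticycControlAdditiveK`, stmt-BirchSwinnertonDyer-19295;
stubs `stub_baseCountTors` / `stub_ptSurj` hinge on `hE` = Milne *ADT* I Thm. 4.10(b) for ALL finite `M`).
THEOREMS ONLY.  HONEST FRAMING: tools for the `μₙ`-instance of `hE` at an arbitrary level `n` (door-c6 g6
proved the prime level, where every non-trivial character of exponent `p` is surjective — the
`CyclicCharacter` API demands surjectivity, FINDING-door-c6-g6 §3); no case of BSD.

For `a · m = N` and a SURJECTIVE character `ψ : Γ_K ↠ ℤ/a` (the image of a character of exponent `N`),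
the class in `H¹(K, μ_N^D)` attached to `ψ` read in `ℤ/N` (`r ↦ r·m`) is `Ψ_* [ψ·id_{μ_a}]` for the
intertwining map `Ψ : Hom(μ_a, μ_a) → Hom(μ_N, μ_N)`, `g ↦ (μ_a ⊆ μ_N) ∘ g ∘ (ζ ↦ ζ^m)` (§1); and for
every `Γ_K`-invariant `u ∈ K̄ˣ`,
`κ_N(u) ∪_N Ψ_*[ψ·id] = H²(μ_a ⊆ μ_N) (κ_a(u) ∪_a [ψ·id])` (§2, a cocycle identity: with `w` an `N`-th
root of `u`, `m·w` is an `a`-th root, and `(ζ ↦ ζ^m)(σw/w) = σ(w^m)/w^m`), so that THE invariant maps give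
`inv_v^{(N)}(loc_v(κ_N(u) ∪ Ψ_*[ψ·id])) = m · inv_v^{(a)}(loc_v(κ_a(u) ∪ [ψ·id]))` (§3,
`localInvariantMap_localization_cohomologyMap_muInclHom`) — the right-hand side being Serre's local symbol
`(ψ, u)_v` (`localInvariantMap_localization_cupProduct_δ₀_eq_neg_apply`, p493213).

References: [SerreLocalFields1979] XIV §1 Prop. 3, XIII §3 Cor. 3; [MilneADT2006] I §0, Thm. 4.10 (b);
[NeukirchSchmidtWingberg2008] I §4 (1.4.2).
-/

noncomputable section

open CategoryTheory Function NumberField IsDedekindDomain Field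
open scoped NumberField ContRepresentation

set_option linter.dupNamespace false
set_option autoImplicit false

namespace Summit.BirchSwinnertonDyer.BirchSwinnertonDyer.Theorems.SchneiderFreeAdditiveX3.PoitouTateReduction

open _root_.TopRep _root_.ContRepresentation _root_.ContinuousCohomology
open Literature.NumberTheory.GaloisRepresentations
open Literature.NumberTheory.GaloisRepresentations.DiscreteGaloisModule
open Literature.NumberTheory.GaloisCohomology
open Literature.AnabelianGeometry.AbsoluteAnabelian
open Literature.AnabelianGeometry.AbsoluteAnabelian.Prop121vii

/-! ## §1. The level change `Ψ : Hom(μ_a, μ_a) → Hom(μ_N, μ_N)`, `g ↦ (μ_a ⊆ μ_N) ∘ g ∘ (·)^m` -/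

section LevelMap

variable {K : Type} [Field K] {a m N : ℕ} [NeZero a] [NeZero N]

omit [NeZero a] [NeZero N] in
/-- The power map `μ_N → μ_a`, `ζ ↦ ζ^m` (`a·m = N`), is `Γ_K`-equivariant. [cite: SerreLocalFields1979, XIII §3] -/
theorem muPow_mu_apply (h : a * m = N) (τ : absoluteGaloisGroup K) (ζ : MuCarrier K N) :
    muPow K N a m h (mu K N τ ζ) = mu K a τ (muPow K N a m h ζ) := by
  apply muVal_injective K a
  rw [muVal_muPow, muVal_apply, muVal_apply, muVal_muPow, smul_pow']

omit [NeZero a] [NeZero N] in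
/-- The inclusion `μ_a ⊆ μ_N` is `Γ_K`-equivariant. [cite: SerreLocalFields1979, XIII §3] -/
theorem muInclusion_mu_apply (haN : a ∣ N) (τ : absoluteGaloisGroup K) (x : MuCarrier K a) :
    muInclusion K haN (mu K a τ x) = mu K N τ (muInclusion K haN x) := by
  apply muVal_injective K N
  rw [muVal_muInclusion, muVal_apply, muVal_apply, muVal_muInclusion]

/-- **The level change `Ψ : Hom(μ_a, μ_a) → Hom(μ_N, μ_N)`, `g ↦ (μ_a ⊆ μ_N) ∘ g ∘ (ζ ↦ ζ^m)`
(`a·m = N`), as a continuous `Γ_K`-intertwining map of the Tate duals.**  On the scalar `r·id_{μ_a}` it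
is `(r·m)·id_{μ_N}`: the embedding `ℤ/a ↪ ℤ/N`, `r ↦ r·m`, on characters.
[cite: MilneADT2006, Ch. I §0 (M^D = Hom(M, μ))] [cite: SerreLocalFields1979, XIV §1] -/
theorem exists_tateDual_muLevel_intertwining (h : a * m = N) :
    ∃ Ψ : ((mu K a).tateDual a).toContRepresentation →ⁱL ((mu K N).tateDual N).toContRepresentation,
      ∀ (g : TateDual K (MuCarrier K a) a) (ζ : MuCarrier K N),
        Ψ g ζ = muInclusion K (Dvd.intro m h) (g (muPow K N a m h ζ)) := by
  have haN : a ∣ N := Dvd.intro m h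
  let Ψadd : TateDual K (MuCarrier K a) a →+ TateDual K (MuCarrier K N) N :=
    { toFun := fun g => ((muInclusion K haN).comp
        ((g : MuCarrier K a →+ MuCarrier K a).comp (muPow K N a m h)) : MuCarrier K N →+ MuCarrier K N)
      map_zero' := DiscreteGaloisModule.TateDual.ext fun ζ => by
        change muInclusion K haN ((0 : TateDual K (MuCarrier K a) a) (muPow K N a m h ζ)) = 0
        rw [DiscreteGaloisModule.TateDual.zero_apply]
        exact map_zero (muInclusion K haN)
      map_add' := fun g g' => DiscreteGaloisModule.TateDual.ext fun ζ => by
        change muInclusion K haN ((g + g') (muPow K N a m h ζ)) =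
          muInclusion K haN (g (muPow K N a m h ζ)) + muInclusion K haN (g' (muPow K N a m h ζ))
        rw [DiscreteGaloisModule.TateDual.add_apply]
        exact map_add (muInclusion K haN) _ _ }
  have hΨ : ∀ (g : TateDual K (MuCarrier K a) a) (ζ : MuCarrier K N),
      Ψadd g ζ = muInclusion K haN (g (muPow K N a m h ζ)) := fun g ζ => rfl
  refine ⟨{ toContinuousLinearMap := ⟨Ψadd.toIntLinearMap, continuous_of_discreteTopology⟩
            isIntertwining' := fun σ => ContinuousLinearMap.ext fun g =>
              DiscreteGaloisModule.TateDual.ext fun ζ => ?_ }, fun g ζ => rfl⟩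
  change Ψadd ((mu K a).tateDual a σ g) ζ = (mu K N).tateDual N σ (Ψadd g) ζ
  rw [hΨ, DiscreteGaloisModule.tateDual_apply_apply_apply, DiscreteGaloisModule.tateDual_apply_apply_apply,
    hΨ, muInclusion_mu_apply, muPow_mu_apply]

end LevelMap

/-! ## §2. `κ_N(u) ∪_N Ψ_*[ψ·id] = H²(μ_a ⊆ μ_N) (κ_a(u) ∪_a [ψ·id])` -/

section CupLevel

variable {K : Type} [Field K] {a m N : ℕ} [NeZero a] [NeZero N]

omit [NeZero a] [NeZero N] in
/-- Pointwise subtraction in a Tate dual. [folklore] -/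
private theorem tateDual_sub_apply' {M : Type} [AddCommGroup M] {n : ℕ} (f g : TateDual K M n) (x : M) :
    (f - g) x = f x - g x := rfl

omit [NeZero a] [NeZero N] in
/-- `(kummerι_a) (ζ^m) = m • (kummerι_N) ζ` in `K̄ˣ` (additive notation) for `ζ ∈ μ_N`, `a·m = N`.
[cite: SerreLocalFields1979, XIV §1] -/
theorem kummerι_muPow (h : a * m = N) (ζ : MuCarrier K N) :
    (kummerι K a).hom (muPow K N a m h ζ) = m • (kummerι K N).hom ζ := by
  apply unitsVal_injective K
  rw [unitsVal_kummerι, muVal_muPow, ← natCast_zsmul, unitsVal_zsmul, unitsVal_kummerι, zpow_natCast]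

/-- **The cup product of a Kummer class with the level-`N` class of a level-`a` character**: for
`a·m = N`, a surjective `ψ : Γ_K ↠ ℤ/a`, the level change `Ψ` of `exists_tateDual_muLevel_intertwining` and
a `Γ_K`-invariant `u ∈ K̄ˣ`,
`H²(μ_a ⊆ μ_N) (κ_a(u) ∪_a [ψ·id_{μ_a}]) = κ_N(u) ∪_N Ψ_* [ψ·id_{μ_a}]` in `H²(K, μ_N)`.  On cocycles: with
`w` an `N`-th root of `u`, `m·w` is an `a`-th root, `κ_N(u)(σ) = σw − w`, `κ_a(u)(σ) = m·(σw − w)`, and both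
sides are `(σ, τ) ↦ (ψ(στ) − ψ(σ)) · m · (σw − w)` read in `μ_N`. [cite: SerreLocalFields1979, XIV §1 Prop. 3]
[cite: NeukirchSchmidtWingberg2008, I §4 (1.4.2)] -/
theorem cohomologyMap_muInclHom_cupProduct_δ₀_scalarCocycle_eq (h : a * m = N)
    (ψ : CyclicCharacter (absoluteGaloisGroup K) a)
    (Ψ : ((mu K a).tateDual a).toContRepresentation →ⁱL ((mu K N).tateDual N).toContRepresentation)
    (hΨ : ∀ (g : TateDual K (MuCarrier K a) a) (ζ : MuCarrier K N),
      Ψ g ζ = muInclusion K (Dvd.intro m h) (g (muPow K N a m h ζ)))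
    (u : (units K).toTopRep.ρ.invariants) :
    haveI : CompactSpace (absoluteGaloisGroup K) := absoluteGaloisGroup_compactSpace K
    cohomologyMap (muInclHom K (Dvd.intro m h)) 2
        (((mu K a).tateDualPairing a).cupProduct ((isSES_kummer K a (NeZero.pos a)).δ₀ u)
          (oneCocycleClass _ (scalarCocycle ψ))) =
      ((mu K N).tateDualPairing N).cupProduct ((isSES_kummer K N (NeZero.pos N)).δ₀ u)
        (galoisCohomology.map Ψ 1 (oneCocycleClass _ (scalarCocycle ψ))) := by
  haveI : CompactSpace (absoluteGaloisGroup K) := absoluteGaloisGroup_compactSpace K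
  have haN : a ∣ N := Dvd.intro m h
  -- an `N`-th root `w` of `u`; `m • w` is an `a`-th root
  obtain ⟨w, hw⟩ := (isSES_kummer K N (NeZero.pos N)).surjective (u : UnitsCarrier K)
  have hwN : ((N : ℕ) : ℤ) • w = (u : UnitsCarrier K) := by rw [← kummerπ_hom_apply]; exact hw
  have hw' : (kummerπ K a).hom (m • w) = (u : UnitsCarrier K) := by
    rw [kummerπ_hom_apply, ← natCast_zsmul, smul_smul, ← Nat.cast_mul, h, hwN]
  rw [(isSES_kummer K a (NeZero.pos a)).δ₀_apply_eq u (m • w) hw',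
    (isSES_kummer K N (NeZero.pos N)).δ₀_apply_eq u w hw,
    ← DiscreteGaloisModule.cohomologyMap_homOfIntertwining, cohomologyMap_oneCocycleClass,
    ContPairing.cupProduct_oneCocycleClass_eq_twoCocycleClass,
    ContPairing.cupProduct_oneCocycleClass_eq_twoCocycleClass, cohomologyMap_twoCocycleClass]
  have hwi : (kummerπ K N).hom w ∈ (units K).toTopRep.ρ.invariants := by rw [hw]; exact u.2
  have hwi' : (kummerπ K a).hom (m • w) ∈ (units K).toTopRep.ρ.invariants := by rw [hw']; exact u.2
  refine congrArg (twoCocycleClass _) (Subtype.ext (ContinuousMap.ext fun q => ?_))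
  obtain ⟨σ, τ⟩ := q
  -- the two Kummer cocycles: `(·)^m ∘ κ_N = κ_a`
  set fN := (isSES_kummer K N (NeZero.pos N)).δ₀Cocycle w hwi with hfN
  set fa := (isSES_kummer K a (NeZero.pos a)).δ₀Cocycle (m • w) hwi' with hfa
  have hpf : muPow K N a m h (fN.1 σ) = fa.1 σ := by
    apply (isSES_kummer K a (NeZero.pos a)).injective
    change (kummerι K a).hom (muPow K N a m h (fN.1 σ)) = (kummerι K a).hom (fa.1 σ)
    rw [kummerι_muPow, hfN, IsSES.f_δ₀Cocycle_apply, hfa, IsSES.f_δ₀Cocycle_apply, map_nsmul, smul_sub]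
  change (muInclHom K haN).hom
      (((scalarCocycle ψ).1 (σ * τ) - (scalarCocycle ψ).1 σ) (fa.1 σ)) =
    (Ψ ((scalarCocycle ψ).1 (σ * τ)) - Ψ ((scalarCocycle ψ).1 σ)) (fN.1 σ)
  rw [tateDual_sub_apply', tateDual_sub_apply', hΨ, hΨ, hpf, muInclHom_hom_apply]
  exact map_sub (muInclusion K haN) _ _

end CupLevel

/-! ## §3. Through THE invariant maps: `inv_v^{(N)}(loc_v(κ_N(u) ∪ Ψ_*[ψ·id])) = m · inv_v^{(a)}(loc_v(κ_a(u) ∪ [ψ·id]))` -/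

section Invariant

variable {K : Type} [Field K] [NumberField K] {a m N : ℕ} [NeZero a] [NeZero N]

/-- **`inv_v^{(N)}(loc_v(κ_N(u) ∪_N Ψ_*[ψ·id_{μ_a}])) = (inv_v^{(a)}(loc_v(κ_a(u) ∪_a [ψ·id_{μ_a}]))) · m`
read in `ℤ/N`** (`a·m = N`), at every finite place `v`, for THE invariant maps `localInvariantMap`:
`cohomologyMap_muInclHom_cupProduct_δ₀_scalarCocycle_eq` and the level change of the invariant maps along
`μ_a ⊆ μ_N` (`localInvariantMap_localization_cohomologyMap_muInclHom`).
[cite: SerreLocalFields1979, XIII §3 Cor. 3, XIV §1 Prop. 3] -/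
theorem localInvariantMap_localization_cupProduct_δ₀_map_scalarCocycle (h : a * m = N)
    (ψ : CyclicCharacter (absoluteGaloisGroup K) a)
    (Ψ : ((mu K a).tateDual a).toContRepresentation →ⁱL ((mu K N).tateDual N).toContRepresentation)
    (hΨ : ∀ (g : TateDual K (MuCarrier K a) a) (ζ : MuCarrier K N),
      Ψ g ζ = muInclusion K (Dvd.intro m h) (g (muPow K N a m h ζ)))
    (u : (units K).toTopRep.ρ.invariants) (v : HeightOneSpectrum (𝓞 K)) :
    haveI : CompactSpace (absoluteGaloisGroup K) := absoluteGaloisGroup_compactSpace K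
    localInvariantMap K N v (galoisCohomology.localization (mu K N) (Sum.inr v) 2
        (((mu K N).tateDualPairing N).cupProduct ((isSES_kummer K N (NeZero.pos N)).δ₀ u)
          (galoisCohomology.map Ψ 1 (oneCocycleClass _ (scalarCocycle ψ))))) =
      (((localInvariantMap K a v (galoisCohomology.localization (mu K a) (Sum.inr v) 2
          (((mu K a).tateDualPairing a).cupProduct ((isSES_kummer K a (NeZero.pos a)).δ₀ u)
            (oneCocycleClass _ (scalarCocycle ψ))))).val * m : ℕ) : ZMod N) := by
  haveI : CompactSpace (absoluteGaloisGroup K) := absoluteGaloisGroup_compactSpace K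
  have hNa : N / a = m := by rw [← h, Nat.mul_div_cancel_left m (NeZero.pos a)]
  rw [← cohomologyMap_muInclHom_cupProduct_δ₀_scalarCocycle_eq h ψ Ψ hΨ u,
    localInvariantMap_localization_cohomologyMap_muInclHom (Dvd.intro m h) v, hNa]

end Invariant

end Summit.BirchSwinnertonDyer.BirchSwinnertonDyer.Theorems.SchneiderFreeAdditiveX3.PoitouTateReduction

end
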